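import Literature.NumberTheory.Rogawski1990.TamagawaSingularMembersFinTFCovol   -- ★ p844690: every currency the organ X2 reads (`IsLocalDeltaTransfer`, `localStableOrbitalIntegral`, `CanonicalTransferMatrix`, …)
import Literature.NumberTheory.Weil1982.UnitaryFinCentralizerTopFormHaar        -- ★ p850468 D1 «TAMAGAWA DENSITY (defs)»: `finTamagawaPartner`, `isHaarMeasure_finTamagawaPartner`
import Literature.NumberTheory.Rogawski1990.TamagawaSingularFinPartnersExplicit   -- ★ D2 «LEVEL-NORMALISED EXPLICIT PARTNERS (defs)»: `TamagawaFinPartners.finPartnerJ`, `finPartnerJ_def`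
import Literature.NumberTheory.Rogawski1990.TamagawaFinPartnersMembers            -- ★ p850539 J4 «MEMBERS»: `exists_forall_isQuotientOf_smul_finTamagawaPartner`
import Literature.NumberTheory.Weil1982.UnitaryFinTopFormGuardSemisimple          -- ★ p850732 J0 «NONDEG»: `forall_lieBallVol_ne_zero_of_guard`
import Literature.NumberTheory.Rogawski1990.TamagawaSingularLevelScalarStable     -- ★ p851039 (LH5-p03): `TamagawaFinPartners.levelScalar_eq_of_corresponds`
import Literature.NumberTheory.Rogawski1990.IsQuotientOfHaarRatio                -- ★ p847850: `IsQuotientOf.exists_eq_smul`, `stableOrbitalIntegralRel_eq_mul_of_forall_eq_smul`, `nnreal_eq_of_smul_eq_smul_of_isHaarMeasure`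
import Literature.NumberTheory.Weil1982.UnitaryFinTopFormSingularEulerMultipliable  -- ★ p851147 Z0: `levelScalar_toLocal_toAdelic_pos`
import HarnessLib

/-!
# THE «X2 RE-LETTERING CERTIFICATE»: organ X2 «8.2.1 (a) AT THE EXPLICIT PARTNERS `t^J`» ⟸ X2♮ «8.2.1 (a) AT THE CANONICAL TAMAGAWA PARTNERS `|ω_β|_v`» (class-uniform rescaling)
# (Rogawski 1990 §1.7 p. 6 «compatible measures», §4.3 pp. 43–44, §8.2 Prop. 8.2.1 (a) p. 118; Kottwitz 1986 Prop. 7.1)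

Topic `NumberTheory/Rogawski1990`; namespace `Literature.NumberTheory.Rogawski1990`.  THEOREMS ONLY (no definition, no named fact, no instance, no notation, no `sorry`).
Cell `pub/hodgecm-mathlib`, crux H413 = `stmt-HodgeConjecture-24833` (supports-only, count-neutral); LH5-p01 (g4), brick (R) of the (M-X2) memo `F0/P3c/LH5/LH5-p01/g4/MEMO-X2-scope.v1.md`
(LH5-plan (g3) GO 13:23:35Z; pattern of ★ O6 `kappaBlockTF_of_isQuotientOf_of_isQuotientOf` p848260 and of the Z1 certificate ★ p851532).  HONEST LABEL: this file proves NO printed statement — it lets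
the LH5b leaf `Cruxes/H413/Lines/F0_P3c_TprimeKappaSystemPaydown.lean` replace its PRINT organ X2 `stub_kappaLocJ` (Prop. 8.2.1 (a) read at OUR level-normalised explicit partners `t^J_v = M_v⁻¹•|ω_β|_v`)
by X2♮ `stub_kappaLocOmega` = the SAME sentence at print's compatible measures, the canonical Tamagawa partners `|ω_β|_v` (★ D1 `finTamagawaPartner`) — one token — and derive X2 in-leaf.
HC_CM is proved only modulo the 7 printed citations (2 remaining: hLiu418 = stmt-HodgeConjecture-24832, h413 = stmt-HodgeConjecture-24833) until rung 0 closes.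

THE MATHEMATICS (all tools ★).  Let `mGs₀` be a Weil-quotient family of `νG_v` by `t^J` on the singular guard (X2's hypothesis) and `m^ω` one by `|ω_β|` (★ J4 `exists_forall_isQuotientOf_smul_finTamagawaPartner`
with weight `1`, J0 ★ `forall_lieBallVol_ne_zero_of_guard`).  At every guarded class `c`, `t^J(out c) = κ • |ω_β|(out c)` and `mGs₀ c = κ⁻¹ • m^ω c` (★ `IsQuotientOf.exists_eq_smul`); `κ = M_v(out c)⁻¹`
by ★ D2 `finPartnerJ_def` and Haar cancellation (★ `nnreal_eq_of_smul_eq_smul_of_isHaarMeasure`); on the stable class of `(γ₀)_v` every class is guarded by `γ₀` itself and `M_v(out c) = M_v((γ₀)_v)`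
(★ `TamagawaFinPartners.levelScalar_eq_of_corresponds`), so `Φ^st_{mGs₀}(γ₀, f) = M_v((γ₀)_v)·Φ^st_{m^ω}(γ₀, f)` (★ `stableOrbitalIntegralRel_eq_mul_of_forall_eq_smul`) `= (M_v·c♮_v)·f^H(γ_H)` by X2♮, with
`M_v((γ₀)_v) > 0` (★ Z0 `levelScalar_toLocal_toAdelic_pos`).

* `kappaLocJ_of_kappaLocOmega` — THE CERTIFICATE: `‹X2♮› → ‹X2 token for token›` under the LH5b frame letters (★ p844690∕LH5b leaf `section Frame` VERBATIM).

## References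
* [Rogawski1990] J. D. Rogawski, *Automorphic Representations of Unitary Groups in Three Variables*, Ann. of Math. Stud. 123 (1990), §1.7 p. 6; §4.3 pp. 43–44; §8.2 Prop. 8.2.1 (a) p. 118.
* [Kottwitz1986] R. E. Kottwitz, Base change for unit elements of Hecke algebras, Compositio Math. 60 (1986), Prop. 7.1.
* [DeitmarEchterhoff2014] A. Deitmar, S. Echterhoff, *Principles of Harmonic Analysis*, 2nd ed. (2014), Thm. 1.5.3.
-/

set_option autoImplicit false

noncomputable section

open MeasureTheory Measure NumberField IsDedekindDomain
open Literature.MeasureTheory.Group Literature.MeasureTheory.RestrictedProduct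
open Literature.Topology.RestrictedProduct Literature.Topology.Algebra.RestrictedProduct
open Literature.NumberTheory.Rogawski1990 Literature.NumberTheory.Automorphic
open Literature.AlgebraicGeometry.ShimuraVarieties (unitaryGroup hermForm)
open scoped Matrix MatrixGroups RestrictedProduct

namespace Literature.NumberTheory.Rogawski1990


/-- The κ-block's eigenvalue binder makes `γ₀` NON-REGULAR (`(X − e₁)²(X − e₂)` is not separable) — copy of ★ O6's private aux. [cite: Rogawski1990, §3.1 p. 19] -/
private theorem not_isRegularElt_of_charpoly_eq_sq_mul_aux' {R : Type*} [Field R] (g : GL (Fin 3) R) (e₁ e₂ : R)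
    (hchar : (g : Matrix (Fin 3) (Fin 3) R).charpoly = (Polynomial.X - Polynomial.C e₁) ^ 2 * (Polynomial.X - Polynomial.C e₂)) :
    ¬ IsRegularElt g := by
  intro hreg
  rw [isRegularElt_iff, hchar] at hreg
  have h2 := (Polynomial.Separable.of_pow (Polynomial.not_isUnit_X_sub_C e₁) two_ne_zero hreg.of_mul_left).2
  exact absurd h2 (by norm_num)


section Frame

variable (L : Type) [Field L] [NumberField L] [IsCMField L]

variable (H' : Matrix (Fin 3) (Fin 3) L) (Tinf : ArchTransferFactor L H')
    -- σ-algebras of the `G′` side (★ (O10-c5) block), of `H_v`, `G_∞`, `H_∞`, and the Haar data — EXACTLY ★ `SingularEllipticTransfer`'s binders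
    [∀ γ : UnitaryGroup.arch (↥(maximalRealSubfield L)) L (IsCMField.complexConj L) 3 H',
      MeasurableSpace (UnitaryGroup.arch (↥(maximalRealSubfield L)) L (IsCMField.complexConj L) 3 H' ⧸ Subgroup.centralizer ({γ} : Set (UnitaryGroup.arch (↥(maximalRealSubfield L)) L (IsCMField.complexConj L) 3 H')))]
    [∀ γ : UnitaryGroup.arch (↥(maximalRealSubfield L)) L (IsCMField.complexConj L) 3 H',
      BorelSpace (UnitaryGroup.arch (↥(maximalRealSubfield L)) L (IsCMField.complexConj L) 3 H' ⧸ Subgroup.centralizer ({γ} : Set (UnitaryGroup.arch (↥(maximalRealSubfield L)) L (IsCMField.complexConj L) 3 H')))]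
    [∀ (v : HeightOneSpectrum (𝓞 ↥(maximalRealSubfield L))) (γ : (UnitaryGroup.cmDatum L 3 H').Local v),
      MeasurableSpace ((UnitaryGroup.cmDatum L 3 H').Local v ⧸ Subgroup.centralizer ({γ} : Set ((UnitaryGroup.cmDatum L 3 H').Local v)))]
    [∀ (v : HeightOneSpectrum (𝓞 ↥(maximalRealSubfield L))) (γ : (UnitaryGroup.cmDatum L 3 H').Local v),
      BorelSpace ((UnitaryGroup.cmDatum L 3 H').Local v ⧸ Subgroup.centralizer ({γ} : Set ((UnitaryGroup.cmDatum L 3 H').Local v)))]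
    [∀ v : HeightOneSpectrum (𝓞 ↥(maximalRealSubfield L)), MeasurableSpace ((UnitaryGroup.cmDatum L 3 H').Local v)] [∀ v : HeightOneSpectrum (𝓞 ↥(maximalRealSubfield L)), BorelSpace ((UnitaryGroup.cmDatum L 3 H').Local v)]
    [MeasurableSpace (UnitaryGroup.arch (↥(maximalRealSubfield L)) L (IsCMField.complexConj L) 3 H')] [BorelSpace (UnitaryGroup.arch (↥(maximalRealSubfield L)) L (IsCMField.complexConj L) 3 H')]
    [∀ v : HeightOneSpectrum (𝓞 ↥(maximalRealSubfield L)), MeasurableSpace ((UnitaryGroup.cmDatum L 2 (Matrix.of fun i j : Fin 2 => if i.val + j.val + 1 = 2 then (1 : L) else 0)).Local v ×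
        (UnitaryGroup.cmDatum L 1 (Matrix.of fun i j : Fin 1 => if i.val + j.val + 1 = 1 then (1 : L) else 0)).Local v)]
    [∀ v : HeightOneSpectrum (𝓞 ↥(maximalRealSubfield L)), BorelSpace ((UnitaryGroup.cmDatum L 2 (Matrix.of fun i j : Fin 2 => if i.val + j.val + 1 = 2 then (1 : L) else 0)).Local v ×
        (UnitaryGroup.cmDatum L 1 (Matrix.of fun i j : Fin 1 => if i.val + j.val + 1 = 1 then (1 : L) else 0)).Local v)]
    [∀ (v : HeightOneSpectrum (𝓞 ↥(maximalRealSubfield L))) (a : ((UnitaryGroup.cmDatum L 2 (Matrix.of fun i j : Fin 2 => if i.val + j.val + 1 = 2 then (1 : L) else 0)).Local v ×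
        (UnitaryGroup.cmDatum L 1 (Matrix.of fun i j : Fin 1 => if i.val + j.val + 1 = 1 then (1 : L) else 0)).Local v)),
      MeasurableSpace (((UnitaryGroup.cmDatum L 2 (Matrix.of fun i j : Fin 2 => if i.val + j.val + 1 = 2 then (1 : L) else 0)).Local v ×
        (UnitaryGroup.cmDatum L 1 (Matrix.of fun i j : Fin 1 => if i.val + j.val + 1 = 1 then (1 : L) else 0)).Local v) ⧸ Subgroup.centralizer ({a} : Set ((UnitaryGroup.cmDatum L 2 (Matrix.of fun i j : Fin 2 => if i.val + j.val + 1 = 2 then (1 : L) else 0)).Local v ×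
        (UnitaryGroup.cmDatum L 1 (Matrix.of fun i j : Fin 1 => if i.val + j.val + 1 = 1 then (1 : L) else 0)).Local v)))]
    [∀ (v : HeightOneSpectrum (𝓞 ↥(maximalRealSubfield L))) (a : ((UnitaryGroup.cmDatum L 2 (Matrix.of fun i j : Fin 2 => if i.val + j.val + 1 = 2 then (1 : L) else 0)).Local v ×
        (UnitaryGroup.cmDatum L 1 (Matrix.of fun i j : Fin 1 => if i.val + j.val + 1 = 1 then (1 : L) else 0)).Local v)),
      BorelSpace (((UnitaryGroup.cmDatum L 2 (Matrix.of fun i j : Fin 2 => if i.val + j.val + 1 = 2 then (1 : L) else 0)).Local v ×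
        (UnitaryGroup.cmDatum L 1 (Matrix.of fun i j : Fin 1 => if i.val + j.val + 1 = 1 then (1 : L) else 0)).Local v) ⧸ Subgroup.centralizer ({a} : Set ((UnitaryGroup.cmDatum L 2 (Matrix.of fun i j : Fin 2 => if i.val + j.val + 1 = 2 then (1 : L) else 0)).Local v ×
        (UnitaryGroup.cmDatum L 1 (Matrix.of fun i j : Fin 1 => if i.val + j.val + 1 = 1 then (1 : L) else 0)).Local v)))]
    [MeasurableSpace (UnitaryGroup.arch (↥(maximalRealSubfield L)) L (IsCMField.complexConj L) 3 (Matrix.of fun i j : Fin 3 => if i.val + j.val + 1 = 3 then (1 : L) else 0))] [BorelSpace (UnitaryGroup.arch (↥(maximalRealSubfield L)) L (IsCMField.complexConj L) 3 (Matrix.of fun i j : Fin 3 => if i.val + j.val + 1 = 3 then (1 : L) else 0))]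
    [∀ γ : UnitaryGroup.arch (↥(maximalRealSubfield L)) L (IsCMField.complexConj L) 3 (Matrix.of fun i j : Fin 3 => if i.val + j.val + 1 = 3 then (1 : L) else 0),
      MeasurableSpace (UnitaryGroup.arch (↥(maximalRealSubfield L)) L (IsCMField.complexConj L) 3 (Matrix.of fun i j : Fin 3 => if i.val + j.val + 1 = 3 then (1 : L) else 0) ⧸ Subgroup.centralizer ({γ} : Set (UnitaryGroup.arch (↥(maximalRealSubfield L)) L (IsCMField.complexConj L) 3 (Matrix.of fun i j : Fin 3 => if i.val + j.val + 1 = 3 then (1 : L) else 0))))]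
    [∀ γ : UnitaryGroup.arch (↥(maximalRealSubfield L)) L (IsCMField.complexConj L) 3 (Matrix.of fun i j : Fin 3 => if i.val + j.val + 1 = 3 then (1 : L) else 0),
      BorelSpace (UnitaryGroup.arch (↥(maximalRealSubfield L)) L (IsCMField.complexConj L) 3 (Matrix.of fun i j : Fin 3 => if i.val + j.val + 1 = 3 then (1 : L) else 0) ⧸ Subgroup.centralizer ({γ} : Set (UnitaryGroup.arch (↥(maximalRealSubfield L)) L (IsCMField.complexConj L) 3 (Matrix.of fun i j : Fin 3 => if i.val + j.val + 1 = 3 then (1 : L) else 0))))]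
    [MeasurableSpace (UnitaryGroup.arch (↥(maximalRealSubfield L)) L (IsCMField.complexConj L) 2 (Matrix.of fun i j : Fin 2 => if i.val + j.val + 1 = 2 then (1 : L) else 0) ×
          UnitaryGroup.arch (↥(maximalRealSubfield L)) L (IsCMField.complexConj L) 1 (Matrix.of fun i j : Fin 1 => if i.val + j.val + 1 = 1 then (1 : L) else 0))]
    [BorelSpace (UnitaryGroup.arch (↥(maximalRealSubfield L)) L (IsCMField.complexConj L) 2 (Matrix.of fun i j : Fin 2 => if i.val + j.val + 1 = 2 then (1 : L) else 0) ×
          UnitaryGroup.arch (↥(maximalRealSubfield L)) L (IsCMField.complexConj L) 1 (Matrix.of fun i j : Fin 1 => if i.val + j.val + 1 = 1 then (1 : L) else 0))]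
    [∀ a : (UnitaryGroup.arch (↥(maximalRealSubfield L)) L (IsCMField.complexConj L) 2 (Matrix.of fun i j : Fin 2 => if i.val + j.val + 1 = 2 then (1 : L) else 0) ×
          UnitaryGroup.arch (↥(maximalRealSubfield L)) L (IsCMField.complexConj L) 1 (Matrix.of fun i j : Fin 1 => if i.val + j.val + 1 = 1 then (1 : L) else 0)),
      MeasurableSpace ((UnitaryGroup.arch (↥(maximalRealSubfield L)) L (IsCMField.complexConj L) 2 (Matrix.of fun i j : Fin 2 => if i.val + j.val + 1 = 2 then (1 : L) else 0) ×
          UnitaryGroup.arch (↥(maximalRealSubfield L)) L (IsCMField.complexConj L) 1 (Matrix.of fun i j : Fin 1 => if i.val + j.val + 1 = 1 then (1 : L) else 0)) ⧸ Subgroup.centralizer ({a} : Set (UnitaryGroup.arch (↥(maximalRealSubfield L)) L (IsCMField.complexConj L) 2 (Matrix.of fun i j : Fin 2 => if i.val + j.val + 1 = 2 then (1 : L) else 0) ×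
          UnitaryGroup.arch (↥(maximalRealSubfield L)) L (IsCMField.complexConj L) 1 (Matrix.of fun i j : Fin 1 => if i.val + j.val + 1 = 1 then (1 : L) else 0))))]
    [∀ a : (UnitaryGroup.arch (↥(maximalRealSubfield L)) L (IsCMField.complexConj L) 2 (Matrix.of fun i j : Fin 2 => if i.val + j.val + 1 = 2 then (1 : L) else 0) ×
          UnitaryGroup.arch (↥(maximalRealSubfield L)) L (IsCMField.complexConj L) 1 (Matrix.of fun i j : Fin 1 => if i.val + j.val + 1 = 1 then (1 : L) else 0)),
      BorelSpace ((UnitaryGroup.arch (↥(maximalRealSubfield L)) L (IsCMField.complexConj L) 2 (Matrix.of fun i j : Fin 2 => if i.val + j.val + 1 = 2 then (1 : L) else 0) ×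
          UnitaryGroup.arch (↥(maximalRealSubfield L)) L (IsCMField.complexConj L) 1 (Matrix.of fun i j : Fin 1 => if i.val + j.val + 1 = 1 then (1 : L) else 0)) ⧸ Subgroup.centralizer ({a} : Set (UnitaryGroup.arch (↥(maximalRealSubfield L)) L (IsCMField.complexConj L) 2 (Matrix.of fun i j : Fin 2 => if i.val + j.val + 1 = 2 then (1 : L) else 0) ×
          UnitaryGroup.arch (↥(maximalRealSubfield L)) L (IsCMField.complexConj L) 1 (Matrix.of fun i j : Fin 1 => if i.val + j.val + 1 = 1 then (1 : L) else 0))))]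
    (νH : ∀ v : HeightOneSpectrum (𝓞 ↥(maximalRealSubfield L)), Measure ((UnitaryGroup.cmDatum L 2 (Matrix.of fun i j : Fin 2 => if i.val + j.val + 1 = 2 then (1 : L) else 0)).Local v ×
        (UnitaryGroup.cmDatum L 1 (Matrix.of fun i j : Fin 1 => if i.val + j.val + 1 = 1 then (1 : L) else 0)).Local v))
    (νG : ∀ v : HeightOneSpectrum (𝓞 ↥(maximalRealSubfield L)), Measure ((UnitaryGroup.cmDatum L 3 H').Local v))
    [∀ v, IsFiniteMeasureOnCompacts (νH v)] [∀ v, (νH v).IsMulRightInvariant]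
    [∀ v, (νG v).IsHaarMeasure] [∀ v, (νG v).IsMulRightInvariant]  -- MAIN-b's strength (F2): `νG_v` Haar
    (νGi : Measure (UnitaryGroup.arch (↥(maximalRealSubfield L)) L (IsCMField.complexConj L) 3 H')) (νqi : Measure (UnitaryGroup.arch (↥(maximalRealSubfield L)) L (IsCMField.complexConj L) 3 (Matrix.of fun i j : Fin 3 => if i.val + j.val + 1 = 3 then (1 : L) else 0)))
    (νHi : Measure (UnitaryGroup.arch (↥(maximalRealSubfield L)) L (IsCMField.complexConj L) 2 (Matrix.of fun i j : Fin 2 => if i.val + j.val + 1 = 2 then (1 : L) else 0) ×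
          UnitaryGroup.arch (↥(maximalRealSubfield L)) L (IsCMField.complexConj L) 1 (Matrix.of fun i j : Fin 1 => if i.val + j.val + 1 = 1 then (1 : L) else 0)))
    [IsFiniteMeasureOnCompacts νGi] [νGi.IsMulRightInvariant] [IsFiniteMeasureOnCompacts νqi] [νqi.IsMulRightInvariant]
    [IsFiniteMeasureOnCompacts νHi] [νHi.IsMulRightInvariant]


set_option maxHeartbeats 16000000 in
set_option synthInstance.maxHeartbeats 800000 in
/-- **THE X2 RE-LETTERING CERTIFICATE**: X2♮ «8.2.1 (a) at the canonical Tamagawa partners `|ω_β|_v`» (`hX2n`, PRINT [Rogawski1990 Prop. 8.2.1 (a)]) implies organ X2 `stub_kappaLocJ` of the LH5b leaf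
TOKEN FOR TOKEN (class-uniform rescaling `t^J = M_v⁻¹ • |ω_β|_v`). [cite: Rogawski1990, §1.7 p. 6; §4.3 pp. 43–44; §8.2 Prop. 8.2.1 (a) p. 118] [cite: Kottwitz1986, Prop. 7.1] [cite: DeitmarEchterhoff2014, Thm. 1.5.3] -/
theorem kappaLocJ_of_kappaLocOmega
    (hX2n :
      ∀ (hK : ∀ v : HeightOneSpectrum (𝓞 ↥(maximalRealSubfield L)), νG v (UnitaryGroup.cmLocalIntegralLevel L 3 H' v : Set ((UnitaryGroup.cmDatum L 3 H').Local v)) = 1)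
    (hanis : ∀ x : Fin 3 → L, hermForm (cmConjRingHom L) H' x x = 0 → x = 0)
    (Sbad : Finset (HeightOneSpectrum (𝓞 ↥(maximalRealSubfield L))))
        (Δ : ∀ v : HeightOneSpectrum (𝓞 ↥(maximalRealSubfield L)), LocalTransferFactor L H' v)
        (mH : ∀ v : HeightOneSpectrum (𝓞 ↥(maximalRealSubfield L)),
          OrbitalMeasureFamily ((UnitaryGroup.cmDatum L 2 (Matrix.of fun i j : Fin 2 => if i.val + j.val + 1 = 2 then (1 : L) else 0)).Local v ×
            (UnitaryGroup.cmDatum L 1 (Matrix.of fun i j : Fin 1 => if i.val + j.val + 1 = 1 then (1 : L) else 0)).Local v))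
        (mG : ∀ v : HeightOneSpectrum (𝓞 ↥(maximalRealSubfield L)), OrbitalMeasureFamily ((UnitaryGroup.cmDatum L 3 H').Local v))
    (m' : OrbitalMeasureFamily (UnitaryGroup.arch (↥(maximalRealSubfield L)) L (IsCMField.complexConj L) 3 H'))
          (m : OrbitalMeasureFamily (UnitaryGroup.arch (↥(maximalRealSubfield L)) L (IsCMField.complexConj L) 3
            (Matrix.of fun i j : Fin 3 => if i.val + j.val + 1 = 3 then (1 : L) else 0)))
          (mHi : OrbitalMeasureFamily (UnitaryGroup.arch (↥(maximalRealSubfield L)) L (IsCMField.complexConj L) 2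
              (Matrix.of fun i j : Fin 2 => if i.val + j.val + 1 = 2 then (1 : L) else 0) ×
            UnitaryGroup.arch (↥(maximalRealSubfield L)) L (IsCMField.complexConj L) 1
              (Matrix.of fun i j : Fin 1 => if i.val + j.val + 1 = 1 then (1 : L) else 0)))
          (t' : ∀ γ' : UnitaryGroup.arch (↥(maximalRealSubfield L)) L (IsCMField.complexConj L) 3 H',
            Measure (Subgroup.centralizer ({γ'} : Set (UnitaryGroup.arch (↥(maximalRealSubfield L)) L (IsCMField.complexConj L) 3 H'))))
          (t : ∀ γ : UnitaryGroup.arch (↥(maximalRealSubfield L)) L (IsCMField.complexConj L) 3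
              (Matrix.of fun i j : Fin 3 => if i.val + j.val + 1 = 3 then (1 : L) else 0),
            Measure (Subgroup.centralizer ({γ} : Set (UnitaryGroup.arch (↥(maximalRealSubfield L)) L (IsCMField.complexConj L) 3
              (Matrix.of fun i j : Fin 3 => if i.val + j.val + 1 = 3 then (1 : L) else 0)))))
          (tH : ∀ γH : UnitaryGroup.arch (↥(maximalRealSubfield L)) L (IsCMField.complexConj L) 2
                (Matrix.of fun i j : Fin 2 => if i.val + j.val + 1 = 2 then (1 : L) else 0) ×
              UnitaryGroup.arch (↥(maximalRealSubfield L)) L (IsCMField.complexConj L) 1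
                (Matrix.of fun i j : Fin 1 => if i.val + j.val + 1 = 1 then (1 : L) else 0),
            Measure (Subgroup.centralizer ({γH} : Set (UnitaryGroup.arch (↥(maximalRealSubfield L)) L (IsCMField.complexConj L) 2
                (Matrix.of fun i j : Fin 2 => if i.val + j.val + 1 = 2 then (1 : L) else 0) ×
              UnitaryGroup.arch (↥(maximalRealSubfield L)) L (IsCMField.complexConj L) 1
                (Matrix.of fun i j : Fin 1 => if i.val + j.val + 1 = 1 then (1 : L) else 0)))))
      (hherm : (H'.map (cmConjRingHom L)).transpose = H')
      (hCTM : CanonicalTransferMatrix L H' Tinf.Δ νH νG Sbad Δ mH mG)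
      (hACS : ArchCanonicalSingularMatrix L H' Tinf νGi νqi νHi hanis m' m mHi t' t tH),
      ∀ (mGs₀ : ∀ v : HeightOneSpectrum (𝓞 ↥(maximalRealSubfield L)), OrbitalMeasureFamily ((UnitaryGroup.cmDatum L 3 H').Local v)),
        (∀ v, (mGs₀ v).IsQuotientOf (fun x : (UnitaryGroup.cmDatum L 3 H').Local v => ∃ γ₀ : (UnitaryGroup.cmDatum L 3 H').Rational, ¬ IsRegularElt (γ₀.val : GL (Fin 3) L) ∧
              Corresponds (UnitaryGroup.conjLocal L (IsCMField.complexConj L) v)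
                ((UnitaryGroup.adelicForm L 3 H').map (UnitaryGroup.adeleToLocal L v))
                ((UnitaryGroup.adelicForm L 3 H').map (UnitaryGroup.adeleToLocal L v))
                ((UnitaryGroup.cmDatum L 3 H').toLocal v ((UnitaryGroup.cmDatum L 3 H').toAdelic γ₀)) x) (νG v) (Literature.NumberTheory.Weil1982.UnitaryFinTopForm.finTamagawaPartner L 3 H' v)) →
        (∀ (γ₀ : (UnitaryGroup.cmDatum L 3 H').Rational) (e₁ e₂ : L), e₁ ≠ e₂ →
          ((((γ₀ : unitaryGroup (cmConjRingHom L) H').val : GL (Fin 3) L) : Matrix (Fin 3) (Fin 3) L) - e₁ • (1 : Matrix (Fin 3) (Fin 3) L)) * ((((γ₀ : unitaryGroup (cmConjRingHom L) H').val : GL (Fin 3) L) : Matrix (Fin 3) (Fin 3) L) - e₂ • (1 : Matrix (Fin 3) (Fin 3) L)) = 0 →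
          (¬ ∃ ζ : L, (((γ₀ : unitaryGroup (cmConjRingHom L) H').val : GL (Fin 3) L) : Matrix (Fin 3) (Fin 3) L) = ζ • (1 : Matrix (Fin 3) (Fin 3) L)) →
          (((γ₀ : unitaryGroup (cmConjRingHom L) H').val : GL (Fin 3) L) : Matrix (Fin 3) (Fin 3) L).charpoly =
            (Polynomial.X - Polynomial.C e₁) ^ 2 * (Polynomial.X - Polynomial.C e₂) →
          ∀ (γH : (UnitaryGroup.cmDatum L 2 (Matrix.of fun i j : Fin 2 => if i.val + j.val + 1 = 2 then (1 : L) else 0)).Rational ×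
              (UnitaryGroup.cmDatum L 1 (Matrix.of fun i j : Fin 1 => if i.val + j.val + 1 = 1 then (1 : L) else 0)).Rational),
            (((γH.1 : unitaryGroup (cmConjRingHom L) (Matrix.of fun i j : Fin 2 => if i.val + j.val + 1 = 2 then (1 : L) else 0)).val : GL (Fin 2) L) : Matrix (Fin 2) (Fin 2) L) =
              e₁ • (1 : Matrix (Fin 2) (Fin 2) L) →
            (((γH.2 : unitaryGroup (cmConjRingHom L) (Matrix.of fun i j : Fin 1 => if i.val + j.val + 1 = 1 then (1 : L) else 0)).val : GL (Fin 1) L) : Matrix (Fin 1) (Fin 1) L) 0 0 = e₂ →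
            ∃ (c : HeightOneSpectrum (𝓞 ↥(maximalRealSubfield L)) → ℂ), (∀ v, c v ≠ 0) ∧
              (∀ (v : HeightOneSpectrum (𝓞 ↥(maximalRealSubfield L)))
                    (fH : (UnitaryGroup.cmDatum L 2 (Matrix.of fun i j : Fin 2 => if i.val + j.val + 1 = 2 then (1 : L) else 0)).Local v × (UnitaryGroup.cmDatum L 1 (Matrix.of fun i j : Fin 1 => if i.val + j.val + 1 = 1 then (1 : L) else 0)).Local v → ℂ) (f : (UnitaryGroup.cmDatum L 3 H').Local v → ℂ),
                  IsLocSmooth f → IsLocSmooth fH → IsLocalDeltaTransfer L H' v (Δ v) (mH v) (mG v) fH f →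
                  localStableOrbitalIntegral L 3 H' v (mGs₀ v) f ((UnitaryGroup.cmDatum L 3 H').toLocal v ((UnitaryGroup.cmDatum L 3 H').toAdelic γ₀)) =
                    c v * fH ((UnitaryGroup.cmDatum L 2 (Matrix.of fun i j : Fin 2 => if i.val + j.val + 1 = 2 then (1 : L) else 0)).toLocal v ((UnitaryGroup.cmDatum L 2 (Matrix.of fun i j : Fin 2 => if i.val + j.val + 1 = 2 then (1 : L) else 0)).toAdelic γH.1),
                      (UnitaryGroup.cmDatum L 1 (Matrix.of fun i j : Fin 1 => if i.val + j.val + 1 = 1 then (1 : L) else 0)).toLocal v ((UnitaryGroup.cmDatum L 1 (Matrix.of fun i j : Fin 1 => if i.val + j.val + 1 = 1 then (1 : L) else 0)).toAdelic γH.2))))) :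
    ∀ (hK : ∀ v : HeightOneSpectrum (𝓞 ↥(maximalRealSubfield L)), νG v (UnitaryGroup.cmLocalIntegralLevel L 3 H' v : Set ((UnitaryGroup.cmDatum L 3 H').Local v)) = 1)
  (hanis : ∀ x : Fin 3 → L, hermForm (cmConjRingHom L) H' x x = 0 → x = 0)
  (Sbad : Finset (HeightOneSpectrum (𝓞 ↥(maximalRealSubfield L))))
      (Δ : ∀ v : HeightOneSpectrum (𝓞 ↥(maximalRealSubfield L)), LocalTransferFactor L H' v)
      (mH : ∀ v : HeightOneSpectrum (𝓞 ↥(maximalRealSubfield L)),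
        OrbitalMeasureFamily ((UnitaryGroup.cmDatum L 2 (Matrix.of fun i j : Fin 2 => if i.val + j.val + 1 = 2 then (1 : L) else 0)).Local v ×
          (UnitaryGroup.cmDatum L 1 (Matrix.of fun i j : Fin 1 => if i.val + j.val + 1 = 1 then (1 : L) else 0)).Local v))
      (mG : ∀ v : HeightOneSpectrum (𝓞 ↥(maximalRealSubfield L)), OrbitalMeasureFamily ((UnitaryGroup.cmDatum L 3 H').Local v))
  (m' : OrbitalMeasureFamily (UnitaryGroup.arch (↥(maximalRealSubfield L)) L (IsCMField.complexConj L) 3 H'))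
        (m : OrbitalMeasureFamily (UnitaryGroup.arch (↥(maximalRealSubfield L)) L (IsCMField.complexConj L) 3
          (Matrix.of fun i j : Fin 3 => if i.val + j.val + 1 = 3 then (1 : L) else 0)))
        (mHi : OrbitalMeasureFamily (UnitaryGroup.arch (↥(maximalRealSubfield L)) L (IsCMField.complexConj L) 2
            (Matrix.of fun i j : Fin 2 => if i.val + j.val + 1 = 2 then (1 : L) else 0) ×
          UnitaryGroup.arch (↥(maximalRealSubfield L)) L (IsCMField.complexConj L) 1
            (Matrix.of fun i j : Fin 1 => if i.val + j.val + 1 = 1 then (1 : L) else 0)))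
        (t' : ∀ γ' : UnitaryGroup.arch (↥(maximalRealSubfield L)) L (IsCMField.complexConj L) 3 H',
          Measure (Subgroup.centralizer ({γ'} : Set (UnitaryGroup.arch (↥(maximalRealSubfield L)) L (IsCMField.complexConj L) 3 H'))))
        (t : ∀ γ : UnitaryGroup.arch (↥(maximalRealSubfield L)) L (IsCMField.complexConj L) 3
            (Matrix.of fun i j : Fin 3 => if i.val + j.val + 1 = 3 then (1 : L) else 0),
          Measure (Subgroup.centralizer ({γ} : Set (UnitaryGroup.arch (↥(maximalRealSubfield L)) L (IsCMField.complexConj L) 3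
            (Matrix.of fun i j : Fin 3 => if i.val + j.val + 1 = 3 then (1 : L) else 0)))))
        (tH : ∀ γH : UnitaryGroup.arch (↥(maximalRealSubfield L)) L (IsCMField.complexConj L) 2
              (Matrix.of fun i j : Fin 2 => if i.val + j.val + 1 = 2 then (1 : L) else 0) ×
            UnitaryGroup.arch (↥(maximalRealSubfield L)) L (IsCMField.complexConj L) 1
              (Matrix.of fun i j : Fin 1 => if i.val + j.val + 1 = 1 then (1 : L) else 0),
          Measure (Subgroup.centralizer ({γH} : Set (UnitaryGroup.arch (↥(maximalRealSubfield L)) L (IsCMField.complexConj L) 2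
              (Matrix.of fun i j : Fin 2 => if i.val + j.val + 1 = 2 then (1 : L) else 0) ×
            UnitaryGroup.arch (↥(maximalRealSubfield L)) L (IsCMField.complexConj L) 1
              (Matrix.of fun i j : Fin 1 => if i.val + j.val + 1 = 1 then (1 : L) else 0)))))
    (hherm : (H'.map (cmConjRingHom L)).transpose = H')
    (hCTM : CanonicalTransferMatrix L H' Tinf.Δ νH νG Sbad Δ mH mG)
    (hACS : ArchCanonicalSingularMatrix L H' Tinf νGi νqi νHi hanis m' m mHi t' t tH),
    ∀ (mGs₀ : ∀ v : HeightOneSpectrum (𝓞 ↥(maximalRealSubfield L)), OrbitalMeasureFamily ((UnitaryGroup.cmDatum L 3 H').Local v)),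
      (∀ v, (mGs₀ v).IsQuotientOf (fun x : (UnitaryGroup.cmDatum L 3 H').Local v => ∃ γ₀ : (UnitaryGroup.cmDatum L 3 H').Rational, ¬ IsRegularElt (γ₀.val : GL (Fin 3) L) ∧
            Corresponds (UnitaryGroup.conjLocal L (IsCMField.complexConj L) v)
              ((UnitaryGroup.adelicForm L 3 H').map (UnitaryGroup.adeleToLocal L v))
              ((UnitaryGroup.adelicForm L 3 H').map (UnitaryGroup.adeleToLocal L v))
              ((UnitaryGroup.cmDatum L 3 H').toLocal v ((UnitaryGroup.cmDatum L 3 H').toAdelic γ₀)) x) (νG v) (TamagawaFinPartners.finPartnerJ L H' v)) →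
      (∀ (γ₀ : (UnitaryGroup.cmDatum L 3 H').Rational) (e₁ e₂ : L), e₁ ≠ e₂ →
        ((((γ₀ : unitaryGroup (cmConjRingHom L) H').val : GL (Fin 3) L) : Matrix (Fin 3) (Fin 3) L) - e₁ • (1 : Matrix (Fin 3) (Fin 3) L)) * ((((γ₀ : unitaryGroup (cmConjRingHom L) H').val : GL (Fin 3) L) : Matrix (Fin 3) (Fin 3) L) - e₂ • (1 : Matrix (Fin 3) (Fin 3) L)) = 0 →
        (¬ ∃ ζ : L, (((γ₀ : unitaryGroup (cmConjRingHom L) H').val : GL (Fin 3) L) : Matrix (Fin 3) (Fin 3) L) = ζ • (1 : Matrix (Fin 3) (Fin 3) L)) →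
        (((γ₀ : unitaryGroup (cmConjRingHom L) H').val : GL (Fin 3) L) : Matrix (Fin 3) (Fin 3) L).charpoly =
          (Polynomial.X - Polynomial.C e₁) ^ 2 * (Polynomial.X - Polynomial.C e₂) →
        ∀ (γH : (UnitaryGroup.cmDatum L 2 (Matrix.of fun i j : Fin 2 => if i.val + j.val + 1 = 2 then (1 : L) else 0)).Rational ×
            (UnitaryGroup.cmDatum L 1 (Matrix.of fun i j : Fin 1 => if i.val + j.val + 1 = 1 then (1 : L) else 0)).Rational),
          (((γH.1 : unitaryGroup (cmConjRingHom L) (Matrix.of fun i j : Fin 2 => if i.val + j.val + 1 = 2 then (1 : L) else 0)).val : GL (Fin 2) L) : Matrix (Fin 2) (Fin 2) L) =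
            e₁ • (1 : Matrix (Fin 2) (Fin 2) L) →
          (((γH.2 : unitaryGroup (cmConjRingHom L) (Matrix.of fun i j : Fin 1 => if i.val + j.val + 1 = 1 then (1 : L) else 0)).val : GL (Fin 1) L) : Matrix (Fin 1) (Fin 1) L) 0 0 = e₂ →
          ∃ (c : HeightOneSpectrum (𝓞 ↥(maximalRealSubfield L)) → ℂ), (∀ v, c v ≠ 0) ∧
            (∀ (v : HeightOneSpectrum (𝓞 ↥(maximalRealSubfield L)))
                  (fH : (UnitaryGroup.cmDatum L 2 (Matrix.of fun i j : Fin 2 => if i.val + j.val + 1 = 2 then (1 : L) else 0)).Local v × (UnitaryGroup.cmDatum L 1 (Matrix.of fun i j : Fin 1 => if i.val + j.val + 1 = 1 then (1 : L) else 0)).Local v → ℂ) (f : (UnitaryGroup.cmDatum L 3 H').Local v → ℂ),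
                IsLocSmooth f → IsLocSmooth fH → IsLocalDeltaTransfer L H' v (Δ v) (mH v) (mG v) fH f →
                localStableOrbitalIntegral L 3 H' v (mGs₀ v) f ((UnitaryGroup.cmDatum L 3 H').toLocal v ((UnitaryGroup.cmDatum L 3 H').toAdelic γ₀)) =
                  c v * fH ((UnitaryGroup.cmDatum L 2 (Matrix.of fun i j : Fin 2 => if i.val + j.val + 1 = 2 then (1 : L) else 0)).toLocal v ((UnitaryGroup.cmDatum L 2 (Matrix.of fun i j : Fin 2 => if i.val + j.val + 1 = 2 then (1 : L) else 0)).toAdelic γH.1),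
                    (UnitaryGroup.cmDatum L 1 (Matrix.of fun i j : Fin 1 => if i.val + j.val + 1 = 1 then (1 : L) else 0)).toLocal v ((UnitaryGroup.cmDatum L 1 (Matrix.of fun i j : Fin 1 => if i.val + j.val + 1 = 1 then (1 : L) else 0)).toAdelic γH.2)))) := by
  intro hK hanis Sbad Δ mH mG m' m mHi t' t tH hherm hCTM hACS mGs₀ hQ γ₀ e₁ e₂ hne hmul hnc hchar γH hγH1 hγH2
  have hherm' : (H'.map (cmConjRingHom L))ᵀ = H' := hherm
  have hreg : ¬ IsRegularElt (γ₀.val : GL (Fin 3) L) := not_isRegularElt_of_charpoly_eq_sq_mul_aux' _ e₁ e₂ hchar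
  -- a Weil-quotient family for the canonical partners `|ω_β|_v` (★ J4 with weight one; J0 on the guard)
  obtain ⟨mω, hQω⟩ := exists_forall_isQuotientOf_smul_finTamagawaPartner L H' hherm' hanis νG (fun _ _ => 1) (fun _ _ _ => one_ne_zero)
    (Literature.NumberTheory.Weil1982.UnitaryFinTopForm.forall_lieBallVol_ne_zero_of_guard L H' hherm' hanis)
  have hQω' : ∀ v, (mω v).IsQuotientOf (fun x : (UnitaryGroup.cmDatum L 3 H').Local v => ∃ γ₀ : (UnitaryGroup.cmDatum L 3 H').Rational, ¬ IsRegularElt (γ₀.val : GL (Fin 3) L) ∧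
            Corresponds (UnitaryGroup.conjLocal L (IsCMField.complexConj L) v)
              ((UnitaryGroup.adelicForm L 3 H').map (UnitaryGroup.adeleToLocal L v))
              ((UnitaryGroup.adelicForm L 3 H').map (UnitaryGroup.adeleToLocal L v))
              ((UnitaryGroup.cmDatum L 3 H').toLocal v ((UnitaryGroup.cmDatum L 3 H').toAdelic γ₀)) x) (νG v)
        (Literature.NumberTheory.Weil1982.UnitaryFinTopForm.finTamagawaPartner L 3 H' v) := by
    intro v
    have h := hQω v
    simp only [one_smul] at h
    exact h
  -- X2♮ for that family
  obtain ⟨cn, hcn0, hcn⟩ := hX2n hK hanis Sbad Δ mH mG m' m mHi t' t tH hherm hCTM hACS mω hQω' γ₀ e₁ e₂ hne hmul hnc hchar γH hγH1 hγH2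
  refine ⟨fun v => ((TamagawaFinPartners.levelScalar L H' v ((UnitaryGroup.cmDatum L 3 H').toLocal v ((UnitaryGroup.cmDatum L 3 H').toAdelic γ₀)) : ℝ) : ℂ) * cn v,
    fun v => mul_ne_zero (Complex.ofReal_ne_zero.2 (Literature.NumberTheory.Weil1982.UnitaryFinTopForm.levelScalar_toLocal_toAdelic_pos L H' hherm' hanis v γ₀).ne') (hcn0 v),
    fun v fH f hf hfH htr => ?_⟩
  haveI : T2Space ((UnitaryGroup.cmDatum L 3 H').Local v) := UnitaryGroup.t2Space_cmDatum_local 3 L H' v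
  -- on the stable class of `(γ₀)_v`: `mGs₀ v c = M_v((γ₀)_v) • mω v c`
  have hw : ∀ c : ConjClasses ((UnitaryGroup.cmDatum L 3 H').Local v),
      IsStablyConj (UnitaryGroup.conjLocal L (IsCMField.complexConj L) v) ((UnitaryGroup.adelicForm L 3 H').map (UnitaryGroup.adeleToLocal L v))
        ((UnitaryGroup.cmDatum L 3 H').toLocal v ((UnitaryGroup.cmDatum L 3 H').toAdelic γ₀)) (Quotient.out c) →
      mGs₀ v c = ((TamagawaFinPartners.levelScalar L H' v ((UnitaryGroup.cmDatum L 3 H').toLocal v ((UnitaryGroup.cmDatum L 3 H').toAdelic γ₀)) : NNReal) : ENNReal) • mω v c := by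
    intro c hc
    have hP : ∃ γ₁ : (UnitaryGroup.cmDatum L 3 H').Rational, ¬ IsRegularElt (γ₁.val : GL (Fin 3) L) ∧
        Corresponds (UnitaryGroup.conjLocal L (IsCMField.complexConj L) v)
          ((UnitaryGroup.adelicForm L 3 H').map (UnitaryGroup.adeleToLocal L v))
          ((UnitaryGroup.adelicForm L 3 H').map (UnitaryGroup.adeleToLocal L v))
          ((UnitaryGroup.cmDatum L 3 H').toLocal v ((UnitaryGroup.cmDatum L 3 H').toAdelic γ₁)) (Quotient.out c) := ⟨γ₀, hreg, hc⟩
    obtain ⟨κ, hκ, htκ, hmκ⟩ := (hQ v).exists_eq_smul (hQω' v) c hP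
    haveI : LocallyCompactSpace ↥(Subgroup.centralizer ({(Quotient.out c : (UnitaryGroup.cmDatum L 3 H').Local v)} : Set ((UnitaryGroup.cmDatum L 3 H').Local v))) :=
      (isClosed_coe_centralizer_singleton (Quotient.out c)).isClosedEmbedding_subtypeVal.locallyCompactSpace
    haveI := Literature.NumberTheory.Weil1982.UnitaryFinTopForm.isHaarMeasure_finTamagawaPartner L 3 H' v (Quotient.out c)
      (Literature.NumberTheory.Weil1982.UnitaryFinTopForm.forall_lieBallVol_ne_zero_of_guard L H' hherm' hanis v _ hP)
    have hκM : κ = (TamagawaFinPartners.levelScalar L H' v (Quotient.out c))⁻¹ :=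
      nnreal_eq_of_smul_eq_smul_of_isHaarMeasure (Literature.NumberTheory.Weil1982.UnitaryFinTopForm.finTamagawaPartner L 3 H' v (Quotient.out c))
        (by rw [← htκ, ← TamagawaFinPartners.finPartnerJ_def])
    have hMM : TamagawaFinPartners.levelScalar L H' v (Quotient.out c) =
        TamagawaFinPartners.levelScalar L H' v ((UnitaryGroup.cmDatum L 3 H').toLocal v ((UnitaryGroup.cmDatum L 3 H').toAdelic γ₀)) :=
      TamagawaFinPartners.levelScalar_eq_of_corresponds (TamagawaFinPartners.Corresponds.symm' hc)
    rw [hmκ, hκM, inv_inv, hMM]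
  have key := stableOrbitalIntegralRel_eq_mul_of_forall_eq_smul (G := (UnitaryGroup.cmDatum L 3 H').Local v)
    (IsStablyConj (UnitaryGroup.conjLocal L (IsCMField.complexConj L) v) ((UnitaryGroup.adelicForm L 3 H').map (UnitaryGroup.adeleToLocal L v))) hw f
  calc localStableOrbitalIntegral L 3 H' v (mGs₀ v) f ((UnitaryGroup.cmDatum L 3 H').toLocal v ((UnitaryGroup.cmDatum L 3 H').toAdelic γ₀))
      = (((((TamagawaFinPartners.levelScalar L H' v ((UnitaryGroup.cmDatum L 3 H').toLocal v ((UnitaryGroup.cmDatum L 3 H').toAdelic γ₀)) : NNReal) : ENNReal)).toReal : ℝ) : ℂ) *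
          localStableOrbitalIntegral L 3 H' v (mω v) f ((UnitaryGroup.cmDatum L 3 H').toLocal v ((UnitaryGroup.cmDatum L 3 H').toAdelic γ₀)) := key
    _ = _ := by rw [hcn v fH f hf hfH htr, ENNReal.coe_toReal, mul_assoc]

end Frame

end Literature.NumberTheory.Rogawski1990

end
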